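import Literature.NumberTheory.Automorphic.ParabolicInductionSupercuspidalProofs   -- ★ Harish-Chandra ⇒: `coinvariantsKer_eq_top_of_isSupercuspidal`; brings `ParabolicGL` (`restrictUnipotentGL`, `unipotentRadicalP`, `IsProperBlocks`)
import Literature.NumberTheory.Rogawski1990.SupercuspidalNotSphericalCofinite        -- ★ `IsSupercuspidal.comp_continuousMulEquiv` (transport of supercuspidality along `≃ₜ*`)
import Literature.NumberTheory.Automorphic.ParabolicInductionAdmissibleProofs       -- ★ `Representation.IsSmooth.comp`
import Literature.NumberTheory.Automorphic.GLReindex                                -- ★ `reindexGL`, `coe_reindexGL`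
import Literature.NumberTheory.Automorphic.GLnCongruenceSubgroups                   -- ★ `mem_unipotentRadicalGL_iff_apply`
import Literature.NumberTheory.Automorphic.ParabolicIndGLDetCharIrreducible         -- ★ `Zelevinsky1980.lastBlockLabel` (the `GL₂ × GL₁` labelling of the consumer)
import Literature.NumberTheory.Automorphic.ReductiveGLn                             -- ★ `transvectionGL`, `coe_transvectionGL`
import HarnessLib

/-!
# R90-TF · S1 «Ch. 12.2 local, SPLIT `v`» — bridge lemma: a SUPERCUSPIDAL representation of the `GL₂`-block has trivial Jacquet module along the
# root group `u₁₀(F)`: every vector lies in `⟨σ(u₁₀ b) y − y⟩`  [Casselman1995 Thm. 5.3.1; BernsteinZelevinsky1976 Thm. 3.21; BushnellHenniart2006 §10.2]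

Cell `hodgecm-mathlib`, crux H413 (`stmt-HodgeConjecture-24833`, lane `--supports … --as helper`), route of record `HCCMUnconditional` (no route verbs;
count-neutral).  Programme R90-TF (brief `director/R90-BRIEF.v2.md` 1f40d54518340a35), section S1 = Ch10-local (base `R90-C10`); seat R90-C10-p03 (g0), dealt
BY NAME «(2) the BRIDGE LEMMA for (1)» in the S1#7 CLOSING PLAN of R90-C10-plan (g0) (`R90/STATUS.md` 2026-09-04T16:09:53Z; target bytes posted by R90-C10-p02 (g0)
16:11:38Z).  CONSUMER: ★ p861747 `R90.S1.parabolicIndGL_intertwiningMap_eq_smul_of_jacquet_root_trivial` (`Theorems/R90S1SplitInducedEndScalarOfCuspidal.lean`), whose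
hypothesis `hσN` is THIS theorem's conclusion TOKEN FOR TOKEN; together they give the SUPERCUSPIDAL branch of socket S1#7 `R90.S1.stub_S1_split_parabolicInd_irreducible_of_unitary`
(`Cruxes/H413/Lines/R90_S1_SplitLocalPacketsB.lean`) in ALL characteristics (R90-C10-p01's assembly).  THEOREMS ONLY (no `def`, no instance, no notation, no named fact,
no `sorry`); imports ★ Literature only; Lines-free.  HONEST LABEL: HC_CM is proved only modulo the 7 printed citations (2 remaining named inputs: hLiu418 =
stmt-HodgeConjecture-24832, h413 = stmt-HodgeConjecture-24833) until rung 0 closes; this file is one brick of one S1 socket and closes nothing global.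

## The mathematics
`σ` a SMOOTH SUPERCUSPIDAL representation (★ `Representation.IsSupercuspidal`: smooth matrix coefficients compactly supported modulo the centre) of the
`GL₂`-block `GL {i : Fin 3 // lastBlockLabel 3 i = false} F` of the standard maximal parabolic `P(2,1) ⊂ GL₃(F)` over a non-archimedean local field `F`.
Relabel the block by `Fin 2` (`0 ↦ 0`, `1 ↦ 1`; ★ `reindexGL`, an isomorphism of topological groups) — supercuspidality and smoothness transport (★
`IsSupercuspidal.comp_continuousMulEquiv`, ★ `IsSmooth.comp`); Harish-Chandra's criterion, direction ⇒ (★ `coinvariantsKer_eq_top_of_isSupercuspidal`, Haar-free,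
irreducibility NOT needed) for the two-block labelling `c = ![1, 0]` of `Fin 2` — whose unipotent radical `U_c` is the LOWER root group `{u₁₀(b)}` (★
`mem_unipotentRadicalGL_iff_apply`) — says `⟨π(u) y − y : u ∈ U_c⟩ = W`; and `u = u₁₀(u₁₀-entry)` relabels to the consumer's `transvectionGL ⟨1⟩ ⟨0⟩ b`
(Mathlib `TransvectionStruct.toMatrix_reindexEquiv`).

[cite: Casselman1995, Thm. 5.3.1] [cite: BernsteinZelevinsky1976, Thm. 3.21] [cite: BushnellHenniart2006, §10.2] [cite: HarishChandra1970, Part I §3 p. 9]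
-/

set_option autoImplicit false

set_option linter.dupNamespace false

noncomputable section

open Matrix
open Literature.NumberTheory.Automorphic Literature.NumberTheory.Automorphic.Zelevinsky1980

namespace Summit.HodgeConjecture.HodgeConjecture.R90.S1

/-- **A SUPERCUSPIDAL `σ` OF THE `GL₂`-BLOCK HAS TRIVIAL JACQUET MODULE ALONG `u₁₀(F)`**: for `σ` smooth and supercuspidal on
`GL {i : Fin 3 // lastBlockLabel 3 i = false} F` (the `GL₂`-block of `P(2,1) ⊂ GL₃(F)`), EVERY `w` lies in the span of the `σ(u₁₀(b)) y − y`
(`u₁₀(b) = transvectionGL ⟨1⟩ ⟨0⟩ b`).  This is the hypothesis `hσN` of ★ `parabolicIndGL_intertwiningMap_eq_smul_of_jacquet_root_trivial` token for token;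
Harish-Chandra ⇒ (★ `coinvariantsKer_eq_top_of_isSupercuspidal` at `c = ![1, 0]`, lower root group) transported along the relabelling `Fin 2 ≃ {i // lastBlockLabel 3 i = false}`
(★ `reindexGL`, ★ `IsSupercuspidal.comp_continuousMulEquiv`, ★ `IsSmooth.comp`).  Irreducibility, admissibility and the characteristic of `F` play no role.
[cite: Casselman1995, Thm. 5.3.1] [cite: BernsteinZelevinsky1976, Thm. 3.21] [cite: BushnellHenniart2006, §10.2] -/
theorem mem_span_transvection_sub_of_isSupercuspidal
    {F : Type*} [Field F] [ValuativeRel F] [TopologicalSpace F] [IsNonarchimedeanLocalField F]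
    {W : Type*} [AddCommGroup W] [Module ℂ W]
    (σ : Representation ℂ (GL {i : Fin 3 // lastBlockLabel 3 i = false} F) W)
    (hσs : σ.IsSmooth) (hsc : σ.IsSupercuspidal) :
    ∀ w : W, w ∈ Submodule.span ℂ (Set.range fun bw : F × W =>
      σ (transvectionGL (⟨1, by decide⟩ : {i : Fin 3 // lastBlockLabel 3 i = false}) ⟨0, by decide⟩ (by decide) bw.1) bw.2
        - bw.2) := by
  intro w
  -- the relabelling `e : Fin 2 ≃ {i : Fin 3 // lastBlockLabel 3 i = false}`, `a ↦ a`
  let e : Fin 2 ≃ {i : Fin 3 // lastBlockLabel 3 i = false} :=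
    { toFun := fun a => ⟨⟨a.1, by omega⟩, decide_eq_false (by simp only [not_le]; omega)⟩
      invFun := fun i => ⟨i.1.1, by
        have h := i.2
        simp only [lastBlockLabel, decide_eq_false_iff_not, not_le] at h
        omega⟩
      left_inv := fun a => Fin.ext rfl
      right_inv := fun i => Subtype.ext (Fin.ext rfl) }
  -- `reindexGL e : GL₂(F) ≃ₜ* GL(block)`
  have hcont : Continuous (reindexGL (k := F) e) :=
    Units.continuous_map (f := (Matrix.reindexAlgEquiv F F e).toMulEquiv.toMonoidHom) (continuous_id.matrix_reindex _ _)
  have hcont' : Continuous (reindexGL (k := F) e).symm :=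
    Units.continuous_map (f := (Matrix.reindexAlgEquiv F F e.symm).toMulEquiv.toMonoidHom) (continuous_id.matrix_reindex _ _)
  let E : GL (Fin 2) F ≃ₜ* GL {i : Fin 3 // lastBlockLabel 3 i = false} F :=
    { reindexGL (k := F) e with continuous_toFun := hcont, continuous_invFun := hcont' }
  -- `π = σ ∘ E` on `GL₂(F)`: smooth and supercuspidal
  have hπs : Representation.IsSmooth (σ.comp (E : GL (Fin 2) F →* GL {i : Fin 3 // lastBlockLabel 3 i = false} F)) :=
    hσs.comp _ hcont
  have hπc : Representation.IsSupercuspidal (σ.comp (E : GL (Fin 2) F →* GL {i : Fin 3 // lastBlockLabel 3 i = false} F)) :=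
    hsc.comp_continuousMulEquiv E
  -- Harish-Chandra ⇒ for the labelling `c = ![1, 0]` (unipotent radical = the lower root group `u₁₀(F)`)
  have hc : IsProperBlocks (![1, 0] : Fin 2 → Fin 2) :=
    ⟨fun a => by fin_cases a <;> [exact ⟨1, rfl⟩; exact ⟨0, rfl⟩], inferInstance⟩
  have hker := coinvariantsKer_eq_top_of_isSupercuspidal _ hπs hπc hc
  -- every generator `π(u) y − y`, `u ∈ U_c`, is a generator `σ(u₁₀ b) y − y` of the target
  have hle : Representation.Coinvariants.ker (Representation.restrictUnipotentGL F (![1, 0] : Fin 2 → Fin 2)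
      (σ.comp (E : GL (Fin 2) F →* GL {i : Fin 3 // lastBlockLabel 3 i = false} F))) ≤
      Submodule.span ℂ (Set.range fun bw : F × W =>
        σ (transvectionGL (⟨1, by decide⟩ : {i : Fin 3 // lastBlockLabel 3 i = false}) ⟨0, by decide⟩ (by decide) bw.1) bw.2 - bw.2) := by
    refine Submodule.span_le.2 ?_
    rintro _ ⟨⟨u, y⟩, rfl⟩
    -- the matrix of `u`: identity except the `(1,0)` entry `b`
    have hu : ((u : standardParabolicGL F (![1, 0] : Fin 2 → Fin 2)) : GL (Fin 2) F) ∈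
        unipotentRadicalGL F (![1, 0] : Fin 2 → Fin 2) := ⟨u, u.2, rfl⟩
    rw [mem_unipotentRadicalGL_iff_apply] at hu
    set b : F := (((u : standardParabolicGL F (![1, 0] : Fin 2 → Fin 2)) : GL (Fin 2) F) : Matrix (Fin 2) (Fin 2) F) 1 0 with hb
    have humat : (((u : standardParabolicGL F (![1, 0] : Fin 2 → Fin 2)) : GL (Fin 2) F) : Matrix (Fin 2) (Fin 2) F) =
        Matrix.transvection 1 0 b := by
      ext i j
      fin_cases i <;> fin_cases j
      · simpa [Matrix.transvection] using hu 0 0 le_rfl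
      · simpa [Matrix.transvection] using hu 0 1 (by decide)
      · simp [Matrix.transvection, hb]
      · simpa [Matrix.transvection] using hu 1 1 le_rfl
    -- relabelled: `E u = u₁₀(b)` in the block
    have hmat : Matrix.reindex e e (Matrix.transvection (1 : Fin 2) 0 b) = Matrix.transvection (e 1) (e 0) b := by
      have h := Matrix.TransvectionStruct.toMatrix_reindexEquiv e ⟨1, 0, by decide, b⟩
      simp only [Matrix.TransvectionStruct.reindexEquiv, Matrix.TransvectionStruct.toMatrix_mk, Matrix.coe_reindexAlgEquiv] at h
      exact h.symm
    have hEu : (E : GL (Fin 2) F →* GL {i : Fin 3 // lastBlockLabel 3 i = false} F)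
        ((u : standardParabolicGL F (![1, 0] : Fin 2 → Fin 2)) : GL (Fin 2) F) =
        transvectionGL (⟨1, by decide⟩ : {i : Fin 3 // lastBlockLabel 3 i = false}) ⟨0, by decide⟩ (by decide) b := by
      refine Units.ext ?_
      rw [coe_transvectionGL]
      exact (congrArg (Matrix.reindex e e) humat).trans hmat
    refine Submodule.subset_span ⟨⟨b, y⟩, ?_⟩
    change σ _ y - y = σ ((E : GL (Fin 2) F →* GL {i : Fin 3 // lastBlockLabel 3 i = false} F)
      ((u : standardParabolicGL F (![1, 0] : Fin 2 → Fin 2)) : GL (Fin 2) F)) y - y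
    rw [hEu]
  have hw : w ∈ (⊤ : Submodule ℂ W) := Submodule.mem_top
  rw [← hker] at hw
  exact hle hw

end Summit.HodgeConjecture.HodgeConjecture.R90.S1

end
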